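import Summits.BirchSwinnertonDyer.BirchSwinnertonDyer.Theses.ShadowIsolation
import Summits.BirchSwinnertonDyer.BirchSwinnertonDyer.Theses.Squeeze
import Summits.BirchSwinnertonDyer.BirchSwinnertonDyer.Theses.TangentCone
import HarnessLib

/-!
# BirchSwinnertonDyer / ShadowIsolation — crux `SelmerRankUB` (stmt-BirchSwinnertonDyer-0130),
# line `greenberg-split`, stub **`stub_noExcessRankBigImage`**: the archimedean (rank) half

The crux `SelmerRankUB` (route ShadowIsolation #4 = route SelmerRank #3, `rfl`-equal decls) is the
upper half of `p^∞`-Selmer BSD at a big-image good ordinary prime: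
`corank_{ℤ_p} Sel_{p^∞}(E/ℚ) ≤ ord_{s=1} L(E,s)` for `p ≥ 5` good ordinary with `ρ̄_{E,p}`
surjective. Line `greenberg-split` cuts it by Greenberg's PROVED identity
`corank Sel_{p^∞} = rank + corank Ш[p^∞]` (`WeierstrassCurve.selmerCorank_eq_mordellWeilRank_add_holds`)
into a Gross–Zagier–Kolyvagin cell (`r_an ≤ 1`), a Ш-half and THIS stub, the archimedean half:

  `stub_noExcessRankBigImage`: for `W` globally minimal elliptic with a big-image good ordinary
  `p ≥ 5` and `ord_{s=1} L(E,s) ≥ 2`, `rank E(ℚ) ≤ ord_{s=1} L(E,s)`.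

As stated the stub is OPEN (it is the sibling crux `SqueezeUB`, stmt-BirchSwinnertonDyer-0496 /
0145, restricted to non-CM curves of analytic rank `≥ 2`: "no excess rank"; first open cell: four
independent rational points, `w = +1`, `L''(E,1) = 0`). This file lands what IS provable now —
the stub's two discharges from REGISTERED items of the summit, and its necessity:

* `noExcessRankBigImage_of_squeezeUB` — from `Squeeze.SqueezeUB` (`∀ W, rank ≤ r_an`): forget the
  prime;
* `noExcessRankBigImage_of_edgeDecay_of_edgeCap` — from route TangentCone's pair
  `EdgeDecay ∧ EdgeCap` ALONE (stmt-17608 / 17609): the two-variable edge squeeze caps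
  `corank_q Sel ≤ r_an` at the admissible prime `q` that `EdgeDecay` returns
  (`selmerCap_of_edgeDecay_of_edgeCap`, verbatim the surjective branch of that route's certified
  deciding theorem, stopped at the inequality), and `rank ≤ corank_q` by Greenberg's identity;
* `noExcessRankBigImage_of_selmerRankUB` — conversely the crux gives the stub
  (`rank ≤ rank + corank Ш = corank Sel ≤ r_an`): the stub is the crux's rank part, weaker than
  the crux, not a restatement of it.

Sources: Greenberg, LNM 1716 (1999), §1 (corank identity); Greenberg–Stevens, Invent. Math. 111
(1993), p. 413 (two-variable `p`-adic `L`-function along the edge, the shape of `EdgeDecay/EdgeCap`).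
Skeleton: `Cruxes/SelmerRankUB/Lines/greenberg_split.lean` (strategist s2), whose kernel-checked
discharges are adapted here. No definition is introduced.
-/

-- D-0017: single-problem summit, so `Summit.BirchSwinnertonDyer.BirchSwinnertonDyer.…` repeats a
-- namespace BY DESIGN.
set_option linter.dupNamespace false

namespace Summit.BirchSwinnertonDyer.BirchSwinnertonDyer.Theorems

open Summit.BirchSwinnertonDyer.BirchSwinnertonDyer.Theses

/-- **NO-EXCESS (big image) from the sibling item `SqueezeUB`** (stmt-BirchSwinnertonDyer-0496,
`∀ W elliptic, rank E(ℚ) ≤ ord_{s=1} L(E,s)`; byte-identical with `LeadingTerm.SqueezeUBR2`,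
stmt-0145): instantiate and forget the prime and the analytic-rank bound. Registered conditional
sub-goal `noExcessRankBigImage_of_squeezeUB` of crux stmt-BirchSwinnertonDyer-0130 (arrow form:
`SqueezeUB →` the registered stub `stub_noExcessRankBigImage` verbatim). [folklore] -/
theorem noExcessRankBigImage_of_squeezeUB :
    Summit.BirchSwinnertonDyer.BirchSwinnertonDyer.Theses.Squeeze.SqueezeUB →
      ∀ (W : WeierstrassCurve ℚ) [W.IsElliptic] [W.IsGloballyMinimal] (p : ℕ) [Fact p.Prime],
        5 ≤ p → W.HasGoodReductionAtPrime p → ¬ (p : ℤ) ∣ W.frobeniusTrace p →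
          W.HasSurjectiveModNGaloisRep p → 2 ≤ W.analyticRank →
            W.mordellWeilRank ≤ W.analyticRank :=
  fun h W _ _ _ _ _ _ _ _ _ => h W

/-- **Necessity: the crux `SelmerRankUB` gives NO-EXCESS (big image).** From
`corank Sel_{p^∞} ≤ r_an` and Greenberg's identity `corank Sel_{p^∞} = rank + corank Ш[p^∞]`
(`selmerCorank_eq_mordellWeilRank_add_holds`, Greenberg 1999 §1) we get `rank ≤ r_an` under the
crux's own hypotheses; so the stub is the crux's rank part (it drops the Ш-term), not a costume of
it. [cite: GreenbergLNM1716, §1] -/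
theorem noExcessRankBigImage_of_selmerRankUB :
    Summit.BirchSwinnertonDyer.BirchSwinnertonDyer.Theses.ShadowIsolation.SelmerRankUB →
      ∀ (W : WeierstrassCurve ℚ) [W.IsElliptic] [W.IsGloballyMinimal] (p : ℕ) [Fact p.Prime],
        5 ≤ p → W.HasGoodReductionAtPrime p → ¬ (p : ℤ) ∣ W.frobeniusTrace p →
          W.HasSurjectiveModNGaloisRep p → 2 ≤ W.analyticRank →
            W.mordellWeilRank ≤ W.analyticRank := by
  intro hUB W _ _ p _ h5 hgood hord hsurj _
  have h := hUB W p h5 hgood hord hsurj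
  rw [W.selmerCorank_eq_mordellWeilRank_add_holds p] at h
  omega

/-- **One-prime Selmer cap from TangentCone's `EdgeDecay ∧ EdgeCap`** (verbatim the surjective
branch of route TangentCone's certified deciding theorem, stopped at the inequality): a globally
minimal elliptic `V/ℚ` with SOME big-image good ordinary prime `≥ 5` and `ord_{s=1} L(V,s) ≥ 2`
has a big-image good ordinary prime `q ≥ 5` (the admissible prime `EdgeDecay` returns) with
`corank_{ℤ_q} Sel_{q^∞}(V/ℚ) ≤ ord_{s=1} L(V,s)`. Mechanism (Greenberg–Stevens 1993, p. 413: the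
two-variable `p`-adic `L`-function restricted to the arithmetic points of weight `k ≡ 2` along the
edge): `EdgeDecay` gives, at every depth `m`, a congruent Hida member whose special value is bounded
BELOW by `p^{-(r_an (m+1) + C₂)}`, `EdgeCap` bounds it ABOVE by `p^{C₁ - corank·(1 + v_p(k-2))}`
with `v_p(k-2) ≥ m`; comparing exponents for `m = C₁ + C₂` forces `corank ≤ r_an`.
[cite: GreenbergStevens1993, p. 413] -/
theorem selmerCap_of_edgeDecay_of_edgeCap (hE : TangentCone.EdgeDecay) (hC : TangentCone.EdgeCap) :
    ∀ (V : WeierstrassCurve ℚ) [V.IsElliptic] [V.IsGloballyMinimal],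
      (∃ (p₀ : ℕ) (_ : Fact p₀.Prime), 5 ≤ p₀ ∧ V.HasGoodReductionAtPrime p₀ ∧
          ¬ (p₀ : ℤ) ∣ V.frobeniusTrace p₀ ∧ V.HasSurjectiveModNGaloisRep p₀) →
      2 ≤ V.analyticRank →
        ∃ (q : ℕ) (_ : Fact q.Prime), 5 ≤ q ∧ V.HasGoodReductionAtPrime q ∧
          ¬ (q : ℤ) ∣ V.frobeniusTrace q ∧ V.HasSurjectiveModNGaloisRep q ∧
            V.selmerCorank q ≤ V.analyticRank := by
  intro V _ _ hex h2
  obtain ⟨hN, p, hp, h5', hgood', hord', hna, hsurj', hBr, a, b, hb, hab, hJ⟩ := hE V h2 hex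
  obtain ⟨J, C₁, hcap⟩ := hC V hN p h5' hgood' hord' hna hsurj' hBr a b hb hab
  obtain ⟨C₂, hm⟩ := hJ J
  have hp1 : (1 : ℝ) < (p : ℝ) := by exact_mod_cast hp.out.one_lt
  have hp0 : (0 : ℝ) < (p : ℝ) := lt_trans zero_lt_one hp1
  have key : ∀ m : ℕ, V.selmerCorank p * (1 + m) ≤ V.analyticRank * (m + 1) + (C₁ + C₂) := by
    intro m
    obtain ⟨k, g, ι, s, hdiv, hkJ, hs, hnew, hordg, hcong, hall⟩ := hm m
    have hdiv' : (2 * b * (p - 1) : ℤ) ∣ (k - 2) := (Dvd.intro _ rfl).trans hdiv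
    obtain ⟨j, hjodd, hj3, hjJ, hcapj⟩ := hcap k g ι s hdiv' hkJ hs hnew hordg hcong
    obtain ⟨hR, hlow⟩ := hall j hjodd hj3 hjJ
    have hup := hcapj hR
    have hk0 : (k - 2) ≠ 0 := by omega
    have hpm : ((p : ℤ) ^ m) ∣ (k - 2) := (Dvd.intro_left _ rfl).trans hdiv
    have hmv : m ≤ padicValInt p (k - 2) := by
      rcases (padicValInt_dvd_iff m (k - 2)).mp hpm with h | h
      · exact absurd h hk0
      · exact h
    set x : ℝ := ‖ι ⟨_, hR⟩‖ with hx
    have hx0 : 0 ≤ x := norm_nonneg _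
    set e₁ : ℕ := V.selmerCorank p * (1 + padicValInt p (k - 2)) with he₁
    set e₂ : ℕ := V.analyticRank * (m + 1) + C₂ with he₂
    have hpow : (p : ℝ) ^ e₁ ≤ (p : ℝ) ^ (C₁ + e₂) := by
      calc (p : ℝ) ^ e₁ = (p : ℝ) ^ e₁ * 1 := by ring
        _ ≤ (p : ℝ) ^ e₁ * (x * (p : ℝ) ^ e₂) :=
            mul_le_mul_of_nonneg_left hlow (pow_nonneg hp0.le _)
        _ = (x * (p : ℝ) ^ e₁) * (p : ℝ) ^ e₂ := by ring
        _ ≤ (p : ℝ) ^ C₁ * (p : ℝ) ^ e₂ :=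
            mul_le_mul_of_nonneg_right hup (pow_nonneg hp0.le _)
        _ = (p : ℝ) ^ (C₁ + e₂) := (pow_add (p : ℝ) C₁ e₂).symm
    have hexp : e₁ ≤ C₁ + e₂ := (pow_le_pow_iff_right₀ hp1).mp hpow
    have hmono : V.selmerCorank p * (1 + m) ≤ e₁ :=
      Nat.mul_le_mul_left _ (by omega)
    omega
  have hUB : V.selmerCorank p ≤ V.analyticRank := by
    have hk := key (C₁ + C₂)
    by_contra hlt
    push Not at hlt
    have h1 : (V.analyticRank + 1) * (1 + (C₁ + C₂)) ≤ V.selmerCorank p * (1 + (C₁ + C₂)) :=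
      Nat.mul_le_mul_right _ hlt
    nlinarith
  exact ⟨p, hp, h5', hgood', hord', hsurj', hUB⟩

/-- **NO-EXCESS (big image) from TangentCone's `EdgeDecay ∧ EdgeCap` alone** (stmt-17608 /
17609; no Ш-input is needed for the RANK bound): `rank ≤ rank + corank Ш[q^∞] = corank_q Sel ≤ r_an`
at the admissible prime `q` of `selmerCap_of_edgeDecay_of_edgeCap`, by Greenberg's identity
(`selmerCorank_eq_mordellWeilRank_add_holds`). Registered conditional sub-goal
`noExcessRankBigImage_of_edgeDecay_of_edgeCap` of crux stmt-BirchSwinnertonDyer-0130 (arrow form: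
`EdgeDecay → EdgeCap →` the registered stub `stub_noExcessRankBigImage` verbatim).
[cite: GreenbergStevens1993, p. 413] -/
theorem noExcessRankBigImage_of_edgeDecay_of_edgeCap :
    Summit.BirchSwinnertonDyer.BirchSwinnertonDyer.Theses.TangentCone.EdgeDecay →
    Summit.BirchSwinnertonDyer.BirchSwinnertonDyer.Theses.TangentCone.EdgeCap →
      ∀ (W : WeierstrassCurve ℚ) [W.IsElliptic] [W.IsGloballyMinimal] (p : ℕ) [Fact p.Prime],
        5 ≤ p → W.HasGoodReductionAtPrime p → ¬ (p : ℤ) ∣ W.frobeniusTrace p →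
          W.HasSurjectiveModNGaloisRep p → 2 ≤ W.analyticRank →
            W.mordellWeilRank ≤ W.analyticRank := by
  intro hE hC W _ _ p hp h5 hgood hord hsurj h2
  obtain ⟨q, hq, -, -, -, -, hcap⟩ :=
    selmerCap_of_edgeDecay_of_edgeCap hE hC W ⟨p, hp, h5, hgood, hord, hsurj⟩ h2
  have hid := W.selmerCorank_eq_mordellWeilRank_add_holds q
  omega

end Summit.BirchSwinnertonDyer.BirchSwinnertonDyer.Theorems
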